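import Summits.PneNP.PneNP.Theorems.SymmetryBudgetNoHiddenOrderProgramRankA

/-!
# `NoHiddenOrder` (stmt-PneNP-14781), (R2c) VI: the window canoniser program — ranks II: the walk shapes

Route `PneNP/SymmetryBudget`; continues `SymmetryBudgetNoHiddenOrderProgramRankA.lean`.  Every source of an analysis gate (`pre_anSrcs`)
and of a transition gate (`pre_trSrcs`) is `Pre` at the gate's coordinates, given that the state's input wires are, that the analysis gates
read are, and that the shape is embedded at the right levels.  Supports stmt-PneNP-14781.
-/

set_option linter.dupNamespace false -- `Summit.PneNP.PneNP.…` (D-0017 single-conjunct layout)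

namespace Summit.PneNP.PneNP.Theorems

open Finset CGBits BranchSum Literature.Computability.Complexity Literature.Computability.Complexity.SymProg

namespace WCanon.R2c

variable {m : ℕ} {t s b base : ℕ}

/-- Sources of an analysis shape (inputs `Pre` at `base`, the shape embedded at `base + anLvl + 1`). [folklore] -/
theorem pre_anSrcs {L : FLab m} {ι : AnIn m} {e : AnGate m → Gt m} (hmem : ∀ v, Pre t s b base (ι.mem v))
    (hval : ∀ v c, Pre t s b base (ι.val v c)) (hcons : ∀ v, Pre t s b base (ι.cons v)) (hdead : Pre t s b base ι.dead)
    (hadj : ∀ u v, Pre t s b base (ι.adj u v)) (he : ∀ g, Pre t s b (base + anLvl g + 1) (Sum.inr (e g))) (g : AnGate m) :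
    ∀ w ∈ anSrcs L ι e g, Pre t s b (base + anLvl g) w := by
  have own : ∀ g g' : AnGate m, anLvl g' < anLvl g → Pre t s b (base + anLvl g) (Sum.inr (e g')) :=
    fun g g' h => (he g').of_le (by omega)
  have inb : ∀ {w : Wire m} (g : AnGate m), Pre t s b base w → Pre t s b (base + anLvl g) w := fun g h => h.of_le (Nat.le_add_right _ _)
  cases g with
  | oPr u v c c' =>
    simp only [anSrcs, Finset.forall_mem_insert, Finset.mem_singleton, forall_eq]
    exact ⟨inb _ (hval _ _), inb _ (hval _ _)⟩
  | oLt u v =>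
    simp only [anSrcs, Finset.forall_mem_image]
    exact fun cc _ => own _ _ (by simp only [anLvl]; omega)
  | oEq u v =>
    simp only [anSrcs, Finset.forall_mem_image]
    exact fun c _ => own _ _ (by simp only [anLvl]; omega)
  | swPr u v a b' =>
    simp only [anSrcs, Finset.forall_mem_insert, Finset.mem_singleton, forall_eq]
    exact ⟨inb _ (hmem _), inb _ (hmem _), own _ _ (by simp only [anLvl]; omega), own _ _ (by simp only [anLvl]; omega)⟩
  | swApr u v a b' =>
    simp only [anSrcs, Finset.forall_mem_insert, Finset.mem_singleton, forall_eq]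
    exact ⟨own _ _ (by simp only [anLvl]; omega), inb _ (hadj _ _)⟩
  | swTw u v g =>
    simp only [anSrcs, anLvl]
    refine fun w' hw' => (pre_ctSrcs (base := base + 4) ?_ ?_ (fun g' => (he (.swTw u v g')).of_le ?_) g w' hw').of_le ?_
    · simp only [Finset.forall_mem_image, Finset.mem_univ, true_imp_iff]
      exact fun ab => (he _).of_le (by simp only [anLvl]; omega)
    · simp only [Finset.forall_mem_image, Finset.mem_univ, true_imp_iff]
      exact fun ab => (he _).of_le (by simp only [anLvl]; omega)
    · simp only [anLvl]; omega
    · omega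
  | swNadj u v =>
    simp only [anSrcs, Finset.mem_singleton, forall_eq]
    exact inb _ (hadj _ _)
  | swNtw u v =>
    simp only [anSrcs, Finset.mem_singleton, forall_eq]
    exact own _ _ (by simp only [anLvl, ctLvl]; omega)
  | swKept u v =>
    simp only [anSrcs, Finset.forall_mem_insert, Finset.mem_singleton, forall_eq]
    exact ⟨inb _ (hadj _ _), own _ _ (by simp only [anLvl]; omega)⟩
  | swAdded u v =>
    simp only [anSrcs, Finset.forall_mem_insert, Finset.mem_singleton, forall_eq]
    exact ⟨own _ _ (by simp only [anLvl]; omega), own _ _ (by simp only [anLvl, ctLvl]; omega)⟩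
  | swSw' u v =>
    simp only [anSrcs, Finset.forall_mem_insert, Finset.mem_singleton, forall_eq]
    exact ⟨own _ _ (by simp only [anLvl]; omega), own _ _ (by simp only [anLvl]; omega)⟩
  | swSw u v =>
    simp only [anSrcs]
    split_ifs
    · simp
    · simp only [Finset.forall_mem_insert, Finset.mem_singleton, forall_eq]
      exact ⟨inb _ (hmem _), inb _ (hmem _), own _ _ (by simp only [anLvl]; omega)⟩
  | rE u v =>
    simp only [anSrcs, Finset.forall_mem_insert, Finset.mem_singleton, forall_eq]
    exact ⟨inb _ (hmem _), inb _ (hmem _), own _ _ (by simp only [anLvl]; omega)⟩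
  | rMid i u w v =>
    simp only [anSrcs, Finset.forall_mem_insert, Finset.mem_singleton, forall_eq]
    exact ⟨own _ _ (by simp only [anLvl, Fin.val_castSucc]; omega), own _ _ (by simp only [anLvl]; omega)⟩
  | rR i u v =>
    simp only [anSrcs]
    split_ifs with h0 huv
    · simp only [Finset.mem_singleton, forall_eq]
      exact inb _ (hmem _)
    · simp
    · simp only [Finset.forall_mem_insert, Finset.forall_mem_image, Finset.mem_univ, true_imp_iff]
      exact ⟨own _ _ (by simp only [anLvl]; omega), fun w => own _ _ (by simp only [anLvl]; omega)⟩
  | mcCy u y =>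
    simp only [anSrcs, Finset.forall_mem_insert, Finset.mem_singleton, forall_eq]
    exact ⟨inb _ (hmem _), own _ _ (by simp only [anLvl]; omega)⟩
  | mcBig u =>
    simp only [anSrcs, Finset.forall_mem_image, Finset.mem_univ, true_imp_iff]
    exact fun y => own _ _ (by simp only [anLvl]; omega)
  | mcCmp v u g =>
    simp only [anSrcs, anLvl]
    refine fun w' hw' => (pre_ccSrcs (base := base + 4) ?_ ?_ (fun g' => (he (.mcCmp v u g')).of_le ?_) g w' hw').of_le ?_
    · simp only [Finset.forall_mem_image, Finset.mem_univ, true_imp_iff]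
      exact fun y => (he _).of_le (by simp only [anLvl]; omega)
    · simp only [Finset.forall_mem_image, Finset.mem_univ, true_imp_iff]
      exact fun y => (he _).of_le (by simp only [anLvl]; omega)
    · simp only [anLvl]; omega
    · omega
  | mcTieLT v u =>
    simp only [anSrcs, Finset.forall_mem_insert, Finset.mem_singleton, forall_eq]
    exact ⟨own _ _ (by simp only [anLvl, ccLvl]; omega), own _ _ (by simp only [anLvl]; omega)⟩
  | mcBo v u =>
    simp only [anSrcs, Finset.forall_mem_insert, Finset.mem_singleton, forall_eq]
    exact ⟨own _ _ (by simp only [anLvl, ccLvl]; omega), own _ _ (by simp only [anLvl]; omega)⟩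
  | mcBetter v u =>
    simp only [anSrcs, Finset.forall_mem_insert, Finset.mem_singleton, forall_eq]
    exact ⟨inb _ (hmem _), own _ _ (by simp only [anLvl]; omega), own _ _ (by simp only [anLvl]; omega)⟩
  | mcNobetter u =>
    simp only [anSrcs, Finset.forall_mem_image, Finset.mem_univ, true_imp_iff]
    exact fun v => own _ _ (by simp only [anLvl]; omega)
  | mcSel u =>
    simp only [anSrcs, Finset.forall_mem_insert, Finset.mem_singleton, forall_eq]
    exact ⟨inb _ (hmem _), own _ _ (by simp only [anLvl]; omega), own _ _ (by simp only [anLvl]; omega)⟩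
  | nmem v =>
    simp only [anSrcs, Finset.mem_singleton, forall_eq]
    exact inb _ (hmem _)
  | ncons v =>
    simp only [anSrcs, Finset.mem_singleton, forall_eq]
    exact inb _ (hcons _)
  | cov u w =>
    simp only [anSrcs, Finset.forall_mem_insert, Finset.mem_singleton, forall_eq]
    exact ⟨own _ _ (by simp only [anLvl]; omega), own _ _ (by simp only [anLvl, Fin.val_last]; omega)⟩
  | all u =>
    simp only [anSrcs, Finset.forall_mem_image, Finset.mem_univ, true_imp_iff]
    exact fun w => own _ _ (by simp only [anLvl]; omega)
  | nall u =>
    simp only [anSrcs, Finset.mem_singleton, forall_eq]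
    exact own _ _ (by simp only [anLvl]; omega)
  | disc u =>
    simp only [anSrcs, Finset.forall_mem_insert, Finset.mem_singleton, forall_eq]
    exact ⟨inb _ (hmem _), own _ _ (by simp only [anLvl]; omega)⟩
  | isAND =>
    simp only [anSrcs, Finset.forall_mem_image, Finset.mem_univ, true_imp_iff]
    exact fun u => own _ _ (by simp only [anLvl]; omega)
  | nisAND =>
    simp only [anSrcs, Finset.mem_singleton, forall_eq]
    exact own _ _ (by simp only [anLvl]; omega)
  | big2 =>
    simp only [anSrcs, Finset.forall_mem_image, Finset.mem_univ, true_imp_iff]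
    exact fun v => inb _ (hmem _)
  | nbig2 =>
    simp only [anSrcs, Finset.mem_singleton, forall_eq]
    exact own _ _ (by simp only [anLvl]; omega)
  | isOR =>
    simp only [anSrcs, Finset.forall_mem_insert, Finset.mem_singleton, forall_eq]
    exact ⟨own _ _ (by simp only [anLvl]; omega), own _ _ (by simp only [anLvl]; omega)⟩
  | stop =>
    simp only [anSrcs, Finset.forall_mem_union, Finset.forall_mem_image]
    exact ⟨⟨fun v _ => inb _ (hmem _), fun v _ => own _ _ (by simp only [anLvl]; omega)⟩,
      ⟨fun v _ => inb _ (hcons _), fun v _ => own _ _ (by simp only [anLvl]; omega)⟩⟩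
  | frozen =>
    simp only [anSrcs, Finset.forall_mem_insert, Finset.mem_singleton, forall_eq]
    exact ⟨inb _ hdead, own _ _ (by simp only [anLvl]; omega)⟩
  | nfrozen =>
    simp only [anSrcs, Finset.mem_singleton, forall_eq]
    exact own _ _ (by simp only [anLvl]; omega)
  | cand y =>
    simp only [anSrcs]
    split_ifs
    · simp only [Finset.forall_mem_insert, Finset.mem_singleton, forall_eq]
      exact ⟨inb _ (hmem _), own _ _ (by simp only [anLvl]; omega), own _ _ (by simp only [anLvl]; omega)⟩
    · simp
  | ncand y =>
    simp only [anSrcs, Finset.mem_singleton, forall_eq]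
    exact own _ _ (by simp only [anLvl]; omega)
  | dom y =>
    simp only [anSrcs, Finset.forall_mem_insert, Finset.forall_mem_image]
    exact ⟨own _ _ (by simp only [anLvl]; omega), fun z _ => own _ _ (by simp only [anLvl]; omega)⟩
  | ndom y =>
    simp only [anSrcs, Finset.mem_singleton, forall_eq]
    exact own _ _ (by simp only [anLvl]; omega)
  | go =>
    simp only [anSrcs, Finset.forall_mem_image]
    exact fun y _ => own _ _ (by simp only [anLvl]; omega)
  | ngo =>
    simp only [anSrcs, Finset.mem_singleton, forall_eq]
    exact own _ _ (by simp only [anLvl]; omega)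
  | andok =>
    simp only [anSrcs]
    split_ifs
    · simp only [Finset.forall_mem_image]
      exact fun uu _ => own _ _ (by simp only [anLvl, Fin.val_last]; omega)
    · simp
  | nandok =>
    simp only [anSrcs, Finset.mem_singleton, forall_eq]
    exact own _ _ (by simp only [anLvl]; omega)

/-- Sources of a transition shape (state inputs `Pre` at `base`, the analysis read `Pre` at `base`, the shape embedded at
`base + trLvl + 1`). [folklore] -/
theorem pre_trSrcs {L : FLab m} {σ : AnIn m} {ea : AnGate m → Gt m} {e : TrGate m → Gt m} (hmem : ∀ v, Pre t s b base (σ.mem v))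
    (hval : ∀ v c, Pre t s b base (σ.val v c)) (hcons : ∀ v, Pre t s b base (σ.cons v)) (hdead : Pre t s b base σ.dead)
    (hadj : ∀ u v, Pre t s b base (σ.adj u v)) (hea : ∀ g, Pre t s b base (Sum.inr (ea g)))
    (he : ∀ g, Pre t s b (base + trLvl g + 1) (Sum.inr (e g))) (g : TrGate m) :
    ∀ w ∈ trSrcs L σ ea e g, Pre t s b (base + trLvl g) w := by
  have own : ∀ g g' : TrGate m, trLvl g' < trLvl g → Pre t s b (base + trLvl g) (Sum.inr (e g')) :=
    fun g g' h => (he g').of_le (by omega)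
  have inb : ∀ {w : Wire m} (g : TrGate m), Pre t s b base w → Pre t s b (base + trLvl g) w := fun g h => h.of_le (Nat.le_add_right _ _)
  cases g with
  | tieD u v =>
    simp only [trSrcs, Finset.forall_mem_insert, Finset.mem_singleton, forall_eq]
    exact ⟨inb _ (hea _), inb _ (hea _), inb _ (hea _)⟩
  | ltI u v =>
    simp only [trSrcs, Finset.forall_mem_insert, Finset.mem_singleton, forall_eq]
    exact ⟨inb _ (hea _), own _ _ (by simp only [trLvl]; omega)⟩
  | bothD u v =>
    simp only [trSrcs, Finset.forall_mem_insert, Finset.mem_singleton, forall_eq]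
    exact ⟨inb _ (hea _), inb _ (hea _)⟩
  | noneD u v =>
    simp only [trSrcs, Finset.forall_mem_insert, Finset.mem_singleton, forall_eq]
    exact ⟨inb _ (hea _), inb _ (hea _)⟩
  | deqv u v =>
    simp only [trSrcs, Finset.forall_mem_insert, Finset.mem_singleton, forall_eq]
    exact ⟨own _ _ (by simp only [trLvl]; omega), own _ _ (by simp only [trLvl]; omega)⟩
  | eqI u v =>
    simp only [trSrcs, Finset.forall_mem_insert, Finset.mem_singleton, forall_eq]
    exact ⟨inb _ (hea _), own _ _ (by simp only [trLvl]; omega)⟩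
  | rv g =>
    simp only [trSrcs, trLvl]
    refine fun w' hw' =>
      (pre_riSrcs (ι := trRIIn σ e) (base := base + 3) (fun v => (hmem v).of_le (Nat.le_add_right _ _))
        (fun u v => (hadj u v).of_le (Nat.le_add_right _ _)) (fun u v => (he (.ltI u v)).of_le ?_) (fun u v => (he (.eqI u v)).of_le ?_)
        (fun g' => (he (.rv g')).of_le ?_) g w' hw').of_le ?_
    · simp only [trLvl]; omega
    · simp only [trLvl]; omega
    · simp only [trLvl]; omega
    · omega
  | takeAnd =>
    simp only [trSrcs, Finset.forall_mem_insert, Finset.mem_singleton, forall_eq]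
    exact ⟨inb _ (hea _), inb _ (hea _), inb _ (hea _)⟩
  | ntakeAnd =>
    simp only [trSrcs, Finset.mem_singleton, forall_eq]
    exact own _ _ (by simp only [trLvl]; omega)
  | takeOr =>
    simp only [trSrcs, Finset.forall_mem_insert, Finset.mem_singleton, forall_eq]
    exact ⟨inb _ (hea _), inb _ (hea _), inb _ (hea _)⟩
  | ntakeOr =>
    simp only [trSrcs, Finset.mem_singleton, forall_eq]
    exact own _ _ (by simp only [trLvl]; omega)
  | newMem w =>
    simp only [trSrcs, Finset.forall_mem_image]
    exact fun u _ => inb _ (hea _)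
  | m1 v =>
    simp only [trSrcs, Finset.forall_mem_insert, Finset.mem_singleton, forall_eq]
    exact ⟨inb _ (hmem _), own _ _ (by simp only [trLvl]; omega)⟩
  | m2 v =>
    simp only [trSrcs, Finset.forall_mem_insert, Finset.mem_singleton, forall_eq]
    exact ⟨own _ _ (by simp only [trLvl]; omega), own _ _ (by simp only [trLvl]; omega)⟩
  | mx v =>
    simp only [trSrcs, Finset.forall_mem_insert, Finset.mem_singleton, forall_eq]
    exact ⟨own _ _ (by simp only [trLvl]; omega), own _ _ (by simp only [trLvl]; omega)⟩
  | v1 v c =>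
    simp only [trSrcs, Finset.forall_mem_insert, Finset.mem_singleton, forall_eq]
    exact ⟨own _ _ (by simp only [trLvl]; omega), own _ _ (by simp only [trLvl, riLvl]; omega)⟩
  | v2 v c =>
    simp only [trSrcs, Finset.forall_mem_insert, Finset.mem_singleton, forall_eq]
    exact ⟨own _ _ (by simp only [trLvl]; omega), inb _ (hval _ _)⟩
  | vx v c =>
    simp only [trSrcs, Finset.forall_mem_insert, Finset.mem_singleton, forall_eq]
    exact ⟨own _ _ (by simp only [trLvl]; omega), own _ _ (by simp only [trLvl]; omega)⟩
  | c1 v =>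
    simp only [trSrcs, Finset.forall_mem_insert, Finset.mem_singleton, forall_eq]
    exact ⟨own _ _ (by simp only [trLvl]; omega), inb _ (hea _)⟩
  | cx v =>
    simp only [trSrcs, Finset.forall_mem_insert, Finset.mem_singleton, forall_eq]
    exact ⟨inb _ (hcons _), own _ _ (by simp only [trLvl]; omega)⟩
  | d1 =>
    simp only [trSrcs, Finset.forall_mem_insert, Finset.mem_singleton, forall_eq]
    exact ⟨inb _ (hea _), inb _ (hea _), inb _ (hea _)⟩
  | d2 =>
    simp only [trSrcs, Finset.forall_mem_insert, Finset.mem_singleton, forall_eq]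
    exact ⟨inb _ (hea _), inb _ (hea _), inb _ (hea _)⟩
  | d3 =>
    simp only [trSrcs, Finset.forall_mem_insert, Finset.mem_singleton, forall_eq]
    exact ⟨inb _ (hea _), inb _ (hea _), inb _ (hea _)⟩
  | dx =>
    simp only [trSrcs, Finset.forall_mem_insert, Finset.mem_singleton, forall_eq]
    exact ⟨inb _ hdead, own _ _ (by simp only [trLvl]; omega), own _ _ (by simp only [trLvl]; omega),
      own _ _ (by simp only [trLvl]; omega)⟩

end WCanon.R2c

end Summit.PneNP.PneNP.Theorems
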